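import Literature.MathematicalPhysics.QuantumFieldTheory.Balaban1983to89.Node00.N24GlueStage9C
import Literature.MathematicalPhysics.QuantumFieldTheory.Balaban1983to89.Node00.CarriersY

/-!
# NODE N24 · (B2) `B16.EndStatementBPrinted D.C` AT THE TOP OF NODE 00's CUMULATIVE CARRIER CHAIN `IsRecordOfRecord₉CB10Y → ₉CB10 → ₉C`
# (`Node00/CarriersB10`, `Node00/CarriersY`, seat node00-def g29): N08 and N06 re-keyed to the PINNED carriers of record by name, every other child as at Stage 9

TRACK A (YM-PLAN §2d, node N24 of 28 = binder B2 `hB : B16.EndStatementBPrinted D.C`), seat `pub-ymgap-dag-n24-a` (-a KNIT-BY-NAME; ROSTER-D0062 re-point «keep the glue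
elaborating against the children's CURRENT statements of record; report which child blocks»).  SEVENTEENTH N24 module, a NEW importing one (append-only growth; modules
1–16 untouched).  THEOREMS ONLY, def-free, sorry-free, standard axioms.

WHY.  Two of the six residual-carrier sockets of module 16 (`N24GlueStage9C.N24_at_record₉C_knit_all_pinned`) are now PINNED by NODE 00's carrier modules, with THE
SAME datum AND world (`isRecordOfRecord₉C_of_isRecordOfRecord₉CB10Y`, `isRecordOfRecord₉CB10_of_isRecordOfRecord₉CB10Y`): at a record of `IsRecordOfRecord₉CB10Y F N D w`
* the [Balaban1985UV3] group of `X` IS print's d = 3 run family of record on SU(N) at the world's block size `L`, and the `b10` leaf IS the located printed slot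
  `PrintedUV3V N L` («SOME version of print's transformations (2) carries Thm 1 (compact reading) ∧ Thm 2 with their printed ∃-prefix» —
  `leaf_b10_iff_of_isRecordOfRecord₉CB10Y`; not closable by junk, not refutable by junk, `CarriersB10` header): **N08's statement of record**;
* the [Balaban1985BackgroundPropagators] bundle `Y` IS def-Y's `Y9OfRecord N θ₃ Mstar ops` over the record's own Stage-3 geometry with values in `SU(N) ⊂ M_N(ℂ)`, the
  OPERATOR LAYER `ops` an explicit residual datum of the record, and the `b9` leaf IS `B9LeafX (Y9OfRecord N θ₃ Mstar ops)` (`leaf_b9_iff_of_isRecordOfRecord₉CB10Y`; def-Y's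
  `B9PinCarriersKLevelV1.b9LeafX_carriersY` the closer by name, geometry ∕ index ∕ backgrounds discharged, the operator layer's obligations displayed): **N06's statement of record**.
So N24's hypothesis list at the newest record replaces module 16's θ₉-keyed leaf-system slot `slots₀₈` by the ONE printed ∃-slot `PrintedUV3V N L` at the world's block
size, and its θ₉-keyed `Y`-socket `slots₀₆` by the `(θ, h, Mstar, ops)`-keyed slot «`B9LeafX` at the bundle of record» — quantified over the HIDDEN operator layer (honest:
a junk layer closes it, def-Y's A5 witness `B9PinCarriersNonVacuity.exists_ops_b9LeafX`; N06 is NOT bookable in ∀-form over `₉CB10Y`; the re-key is LOCATION-positive and STRENGTH-neutral, §0).  Every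
other child enters EXACTLY as in module 16, through the refinement to `₉C` (the ₉C-presenting parameters of a `₉CB10Y` record are the pinned ones,
`Stage9Params.toStage5_pinB10 ∕ _pinY`; the θ₉-keyed sockets of module 16 quantify over every presentation and keep their pin clause).

WHAT THIS FILE PROVES.
§0 `N24_forall_opsSlot_b9_iff₉CB10Y` (the `(θ, h, Mstar, ops)`-keyed [B9] slot ↔ the world's leaf `∀ P, (w.up P).b9` at a `₉CB10Y` record — strength-neutral vs module 16's
   `Y`-socket, `N24_forall_pinned_b9Leaf_iff₉C`); `N24_b10_leaf_iff_printedUV3V₉CB10Y` (the `b10` leaf at every run ↔ the printed slot at SOME odd block size `L > 1` with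
   `w.L = L` — g29's face, cited); `N24_b10_main_of_isRecordOfRecord₉CB10Y_of_printedUV3V` (N08 from the printed slot AT THE WORLD'S BLOCK SIZE); `N24_b9_main_of_isRecordOfRecord₉CB10Y_of_opsSlot`
   (N06 from the ops-keyed slot = g29's `b9_main_of_isRecordOfRecord₉CB10Y_of_slots`, re-exported under the N24 name for the index).
§1 `N24_at_record₉CB10Y` (module 16's ENGINE through the refinement); **`N24_at_record₉CB10Y_knit_all_pinned`** — (B2) at a `₉CB10Y` record, EVERY CHILD BY NAME at the
   record's own parameters: hypothesis list = WHICH CHILD BLOCKS at `₉CB10Y`, kernel form (N08 one printed ∃-slot; N06 the operator layer's leaf; four residual sockets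
   X-[B8] ∕ Z ∕ W ∕ B13; N09's three Stage-9 inputs; the four N11∧N13 slots at the objects of record; the β-box); `N24_at_record₉CB10Y_knit_N09_N11_N13`.
§2 `N24_at_record₉CB10Y_knit_all_of_betaMerged_pinned` — the β-binders READ AT THE MERGED β OF RECORD (module 16 §2's iffs at the record's presenting `θ`; the datum of a
   `₉CB10Y` record IS `datumOfRecord₉ F N θ h` — the pins are UP-SIDE).  β-VERSION SENTENCE (director RIDER №6 ∕ LINE №44): β here = `betaOfRecord₉ = betaOfRecord₈ ∘
   toStage8Params` (RN-representative); NO β-side binder booked at Stage 9 or on the carrier chain; the version repair rides in `Record10` (`betaOfRecord₉c`).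
§3 `N24_stabilityB_itemShape₉CB10Y_knit_all_pinned` — the item body (stmt-QuantumFields-19183, rev 0) in its literal shape at general `N`.
§4 `N24_isRecordOfRecord₉CB10Y_reletter` — `₉CB10Y` is closed under γ-lowering re-lettering of the world (`hRL` of design E; not instantiated).
§5 `N24_leaves_iff_binders₉CB10Y` — logical status of the remaining socket display (module 16 §5 through the refinement).

DEDUP ∕ CURRENCY.  The Summits-side route-level closers of seats dag-n08-a (`Theorems/BalabanUVNodesN08AtRecord9CB10.lean`, REACTIVATE №3) and dag-n22-b
(`Theorems/BalabanUVNodesN06AtRecord9CB10Y.lean`, REBALANCE №44) read `S_N08 ∕ S_N06 Rec := AtRecord Rec Dag.Bk_main` over the same g29 faces; this Literature module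
neither imports nor restates them — it consumes `CarriersB10 ∕ CarriersY` BY NAME and displays the two children's slots inside N24's composition.
VACUITY ∕ A1 (director LINE №45 (3)).  `IsRecordOfRecord₉CB10Y` is inhabited iff `IsRecordOfRecord₉C` is (`exists_world_isRecordOfRecord₉CB10Y`: the pins add data, no
proviso) iff SOME admissible Stage-9 parameter satisfies `Stage9Params.Provisos` — K0 `Record9Inhabited`, OWED; every theorem below is a per-record implication and a
∀-form over `₉CB10Y` is NOT-A-DISCHARGE.  HONEST FRAMING: kernel bookkeeping BY NAME; nothing of Bałaban's asserted; `PrintedUV3V` TYPED not proved (N08's object gap);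
no operator of [B9] defined (N06's); N24 COMPOSITE — no discharge, no count; one finite T⁴ programme at fixed ε; NOT continuum ∕ ℝ⁴ ∕ OS ∕ mass gap ∕ Clay.
-/

noncomputable section

open scoped Matrix.Norms.L2Operator

namespace Literature.MathematicalPhysics.QuantumFieldTheory.Balaban1983to89.Node00

open DagBinding T4Continuum T4DatumAssembly FlowStepRuns AveragingRT
open FlowStep (box_mono)

variable {F : T4Family} {N : ℕ} [NeZero N] {D : FiniteEpsData F (SU N)} {w : WorldP}

/-! ## §0. The two pinned children at a `₉CB10Y` record: N08 from the printed slot, N06 from the operator layer's leaf -/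

/-- **The `(θ, h, Mstar, ops)`-keyed [B9] slot IS the world's leaf** at a `₉CB10Y` record: «for every admissible Stage-9 parameter with provisos, floor and operator layer
presenting the datum and binding the world over the cumulative pin: `B9LeafX (Y9OfRecord N θ.toStage3Params Mstar ops)`» ↔ `∀ P, (w.up P).b9` (`upOfRecord₅C_pinY_b9_iff`,
`Iff.rfl` at the pinned view).  Hence the re-keyed N06 slot of this module is STRENGTH-NEUTRAL against module 16's `Y`-socket (`N24_forall_pinned_b9Leaf_iff₉C` through
`isRecordOfRecord₉C_of_isRecordOfRecord₉CB10Y`) and LOCATION-POSITIVE (the bundle is def-Y's, of record). [cite: Balaban1985BackgroundPropagators, Thms 3.1–3.15 pp.397–432 (the leaf; bookkeeping: the pinned bundle of record)] -/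
theorem N24_forall_opsSlot_b9_iff₉CB10Y (h : IsRecordOfRecord₉CB10Y F N D w) :
    (∀ (θ : Stage9Params F N) (hP : θ.Provisos) (Mstar : ℕ) (ops : OpsY N θ.toStage3Params Mstar), θ.Admissible →
        D = datumOfRecord₉ F N θ hP →
        (∀ P, w.up P = upOfRecord₅C F N (((θ.toStage5 F N).pinB10 F N).pinY F N (Y9OfRecord N θ.toStage3Params Mstar ops)) P) →
          B9LeafX (Y9OfRecord N θ.toStage3Params Mstar ops)) ↔
      ∀ P : B12.RunParams, (w.up P).b9 := by
  refine ⟨fun hops P => ?_, fun hw θ' hP' Mstar' ops' _ _ hup' => ?_⟩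
  · obtain ⟨θ, hP, Mstar, ops, hθ, hD, -, -, -, hup⟩ := h
    rw [hup P]
    exact (upOfRecord₅C_pinY_b9_iff F N _ _ P).2 (hops θ hP Mstar ops hθ hD hup)
  · have h9 : (w.up ⟨0, 0, 0⟩).b9 := hw ⟨0, 0, 0⟩
    rw [hup' ⟨0, 0, 0⟩] at h9
    exact (upOfRecord₅C_pinY_b9_iff F N _ _ ⟨0, 0, 0⟩).1 h9

/-- **The `b10` leaf at a `₉CB10Y` record IS the printed slot of [Balaban1985UV3] at the world's block size** (node00-def g29's `leaf_b10_iff_of_isRecordOfRecord₉CB10Y`,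
re-exported under the N24 index name): for SOME odd `L > 1` with `w.L = L`, `(leavesP w P).b10 ↔ PrintedUV3V N L` at every run. [cite: Balaban1985UV3, Thm 1 p.257 (compact reading) + Thm 2 p.272] -/
theorem N24_b10_leaf_iff_printedUV3V₉CB10Y (h : IsRecordOfRecord₉CB10Y F N D w) :
    ∃ L : ℕ, (Odd L ∧ 1 < L) ∧ w.L = (L : ℝ) ∧ ∀ P : B12.RunParams, (leavesP w P).b10 ↔ PrintedUV3V N L :=
  leaf_b10_iff_of_isRecordOfRecord₉CB10Y h

/-- **N08 · [Balaban1985UV3] AT EVERY RUN OF A `₉CB10Y` RECORD FROM THE PRINTED SLOT AT THE WORLD'S BLOCK SIZE** — N08's statement of record on the carrier chain: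
«for the odd block size `L > 1` of the world, SOME version of print's renormalization transformations (2) carries Thm 1 (compact reading) ∧ Thm 2» ⇒ `Dag.B10_main` at
every run (in-edges unused; `leaf_b10_iff_of_isRecordOfRecord₉CB10Y`).  Replaces module 16's θ₉-keyed leaf-system slot `slots₀₈`. [cite: Balaban1985UV3, (1)–(5) p.256, Thm 1 p.257 (compact reading) + Thm 2 p.272] -/
theorem N24_b10_main_of_isRecordOfRecord₉CB10Y_of_printedUV3V (h : IsRecordOfRecord₉CB10Y F N D w)
    (hUV₀₈ : ∀ L : ℕ, Odd L → 1 < L → w.L = (L : ℝ) → PrintedUV3V N L) (P : B12.RunParams) : Dag.B10_main (leavesP w P) := by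
  obtain ⟨L, hL, hwL, hiff⟩ := leaf_b10_iff_of_isRecordOfRecord₉CB10Y h
  exact fun _ _ _ _ _ _ => (hiff P).2 (hUV₀₈ L hL.1 hL.2 hwL)

/-- **N06 · [Balaban1985BackgroundPropagators] AT EVERY RUN OF A `₉CB10Y` RECORD FROM THE OPERATOR LAYER'S LEAF AT THE BUNDLE OF RECORD** — N06's statement of record on
the carrier chain (node00-def g29's `b9_main_of_isRecordOfRecord₉CB10Y_of_slots`, re-exported under the N24 index name): «for every `(θ, h, Mstar, ops)` presenting the record,
`B9LeafX (Y9OfRecord N θ.toStage3Params Mstar ops)`» ⇒ `Dag.B9_main` at every run (in-edges unused).  HONEST: the slot quantifies over the HIDDEN operator layer `ops` (Bałaban's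
propagators, not defined in the tree) and is met by a junk layer (def-Y's A5 witness `B9PinCarriersNonVacuity.exists_ops_b9LeafX`, cited not re-derived); what def-Y's knit
`B9PinCarriersKLevelV1.b9LeafX_carriersY` discharges
at the record is the geometry ∕ index ∕ backgrounds of [B9]. Replaces module 16's θ₉-keyed `Y`-socket `slots₀₆`. [cite: Balaban1985BackgroundPropagators, Thm 3.1 p.397 + p.399 (the family), Thms 3.1–3.15 pp.397–432] -/
theorem N24_b9_main_of_isRecordOfRecord₉CB10Y_of_opsSlot (h : IsRecordOfRecord₉CB10Y F N D w)
    (hops₀₆ : ∀ (θ : Stage9Params F N) (hP : θ.Provisos) (Mstar : ℕ) (ops : OpsY N θ.toStage3Params Mstar), θ.Admissible →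
      D = datumOfRecord₉ F N θ hP →
      (∀ P, w.up P = upOfRecord₅C F N (((θ.toStage5 F N).pinB10 F N).pinY F N (Y9OfRecord N θ.toStage3Params Mstar ops)) P) →
        B9LeafX (Y9OfRecord N θ.toStage3Params Mstar ops))
    (P : B12.RunParams) : Dag.B9_main (leavesP w P) :=
  b9_main_of_isRecordOfRecord₉CB10Y_of_slots h hops₀₆ P

/-! ## §1. (B2) at the top of the carrier chain: the engine, and every child at the record's own parameters by name -/

/-- **N24 · (B2) AT A `₉CB10Y` RECORD — the composition ENGINE** (module 16's `N24_at_record₉C` through `isRecordOfRecord₉C_of_isRecordOfRecord₉CB10Y`; same datum, same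
world): nine by-name binders N05 … N13 at every run + the β-box on `]0, γ₀]^{k+1}`, `γ₀ ≥ w.γ` ⇒ `B16.EndStatementBPrinted D.C`; N01 N02 N03 N04 inside.
[cite: Balaban1989LargeFieldII, Thm 1 p.355 + pp.387, 391; Balaban1988Convergent, Thm 1 p.262, (0.2) p.244; Balaban1987RG1, (1.22) p.264 (bookkeeping over the carrier-pinned Stage-9 record)] -/
theorem N24_at_record₉CB10Y (h : IsRecordOfRecord₉CB10Y F N D w) {γ₀ : ℝ} (hγ₀ : w.γ ≤ γ₀)
    (h05 : ∀ P : B12.RunParams, Dag.B8_main (leavesP w P)) (h06 : ∀ P : B12.RunParams, Dag.B9_main (leavesP w P))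
    (h07 : ∀ P : B12.RunParams, Dag.B11_main (leavesP w P)) (h08 : ∀ P : B12.RunParams, Dag.B10_main (leavesP w P))
    (h09 : ∀ P : B12.RunParams, Dag.B12_main (leavesP w P)) (h10 : ∀ P : B12.RunParams, Dag.B13_main (leavesP w P))
    (h11 : ∀ P : B12.RunParams, Dag.B14_main (leavesP w P)) (h12 : ∀ P : B12.RunParams, Dag.B15_main (leavesP w P))
    (h13 : ∀ P : B12.RunParams, Dag.B16_main (leavesP w P))
    (hlo : FlowStep.BetaLowerH w.b γ₀ D.βfun) (hhi : FlowStep.BetaUpperH w.βup γ₀ D.βfun) :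
    B16.EndStatementBPrinted D.C :=
  N24_at_record₉C (isRecordOfRecord₉C_of_isRecordOfRecord₉CB10Y h) hγ₀ h05 h06 h07 h08 h09 h10 h11 h12 h13 hlo hhi

/-- **N24 · (B2) AT A `₉CB10Y` RECORD, EVERY PAPER CHILD ENTERED AT THE RECORD'S OWN PARAMETERS BY NAME — the two carrier-pinned children at their statements of record.**
N01 N02 N03 N04 theorems (inside); **N08** the printed slot `PrintedUV3V N L` at the world's odd block size `L > 1` ([Balaban1985UV3] Thms 1 + 2 in SOME version of (2));
**N06** the operator layer's leaf `B9LeafX (Y9OfRecord N θ₃ Mstar ops)` for every presenting `(θ, h, Mstar, ops)`; N05 N07 N12 module 16's θ₉-keyed pinned carrier sockets on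
the residual groups X-[B8] ∕ Z ∕ W, N10 its B13 socket (all with the pin clause, quantified over every ₉C-presentation of the world — the pinned ones included,
`Stage9Params.toStage5_pinB10 ∕ _pinY`); **N09** seat dag-n09-a's `slot12 ∕ h11dom ∕ hcomp` (`B12NodeKnitRecord9.b12_main_at_record₉C_of_leaf`); **N11 ∧ N13** seat
dag-n13-a's junction slots (S0) (S1ᵀ) (R₉) (UV₉) at the objects of record (`B16NodeKnitRecord9.nodes_N11_N13_of_isRecordOfRecord₉C`); β-box on `D.βfun` over `]0, γ₀]`.
THE HYPOTHESIS LIST IS «WHICH CHILD BLOCKS AT ₉CB10Y» IN KERNEL FORM: no pure node binder; N08 = one printed ∃-slot; N06 = the hidden operator layer's obligations; four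
residual-carrier sockets (X-[B8], Z, W, B13 — the successor pins `CarriersZ ∕ W15OfRecord ∕ Record10Carriers`); N09's three Stage-9 inputs; the four N11∕N13 slots
(FORMAT FACE for (S0)(S1ᵀ)(R₉); (UV₉) = (0.1) on the densities of record); the β-box (NODE O ∕ [I] p. 264). [cite: Balaban1989LargeFieldII, Thm 1 p.355, (0.1) pp.355–356, p.387, p.391; Balaban1988Convergent, Thm 1 p.262, Theorem p.245, p.244, (2.18) p.257; Balaban1987RG1, Thm 1 p.259, Thm 3 p.264, Lemma 4 (3.53) p.280, (1.22) p.264; Balaban1985UV3, (1)–(5) p.256, Thm 1 p.257 + Thm 2 p.272; Balaban1985BackgroundPropagators, Thms 3.1–3.15 pp.397–432; Balaban1985RegularSpaces, Thms 2, 4, 8 pp.83–101; Balaban1985Variational, Thm 1 p.279; Balaban1988RG2Cluster, Lemmas 1–3 pp.9, 11, 20; Balaban1989LargeFieldI, Prop. 1 p.194; Balaban1984PropagatorsII, pp.234–249 (bookkeeping over the carrier-pinned Stage-9 record)] -/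
theorem N24_at_record₉CB10Y_knit_all_pinned (h : IsRecordOfRecord₉CB10Y F N D w) {γ₀ : ℝ} (hγ₀ : w.γ ≤ γ₀)
    (slots₀₅ : ∀ (θ : Stage9Params F N) (hP : θ.Provisos), θ.Admissible → D = datumOfRecord₉ F N θ hP →
      (∀ P, w.up P = upOfRecord₅C F N (θ.toStage5 F N) P) → ∀ P : B12.RunParams,
        B8LeafR (θ.res.X P).d8 (θ.res.X P).L8 (θ.res.X P).C₂ (θ.res.X P).B₁' (θ.res.X P).B₀' (θ.res.X P).B₁ (θ.res.X P).B₂ (θ.res.X P).c₁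
          (θ.res.X P).inp8 (θ.res.X P).B₀β (θ.res.X P).loc8 (θ.res.X P).fam8R (θ.res.X P).lan8 (θ.res.X P).cub8 (θ.res.X P).toAxial8)
    (hops₀₆ : ∀ (θ : Stage9Params F N) (hP : θ.Provisos) (Mstar : ℕ) (ops : OpsY N θ.toStage3Params Mstar), θ.Admissible →
      D = datumOfRecord₉ F N θ hP →
      (∀ P, w.up P = upOfRecord₅C F N (((θ.toStage5 F N).pinB10 F N).pinY F N (Y9OfRecord N θ.toStage3Params Mstar ops)) P) →
        B9LeafX (Y9OfRecord N θ.toStage3Params Mstar ops))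
    (slots₀₇ : ∀ (θ : Stage9Params F N) (hP : θ.Provisos), θ.Admissible → D = datumOfRecord₉ F N θ hP →
      (∀ P, w.up P = upOfRecord₅C F N (θ.toStage5 F N) P) → ∀ P : B12.RunParams, B11Leaf (θ.res.Z P))
    (hUV₀₈ : ∀ L : ℕ, Odd L → 1 < L → w.L = (L : ℝ) → PrintedUV3V N L)
    (slot12 : ∀ (θ : Stage9Params F N) (hP : θ.Provisos), θ.Admissible → D = datumOfRecord₉ F N θ hP → w.γ ≤ θ.γ →
      (∀ P, w.up P = upOfRecord₅C F N (θ.toStage5 F N) P) → ∀ P : B12.RunParams, B12Sec2to5.Lemma4Printed (θ.res.X P).F12 (θ.res.X P).c12)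
    (h11dom : ∀ (θ : Stage9Params F N) (hP : θ.Provisos), θ.Admissible → D = datumOfRecord₉ F N θ hP → w.γ ≤ θ.γ →
      ∀ (p : B12.RunParams) (k : ℕ), k ≤ p.K →
        ∀ V ∈ domAltOfRecord F N θ.ν p.K k, UkExists F N p.K k θ.εbg V ∧ UniqueUkOrbit F N p.K k θ.εbg V)
    (hcomp : ∀ (θ : Stage9Params F N) (hP : θ.Provisos), θ.Admissible → D = datumOfRecord₉ F N θ hP → w.γ ≤ θ.γ →
      ∀ (p : B12.RunParams) (k : ℕ), k ≤ p.K →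
        HCompT F N (TOfRecord F N) (chi7 F N θ.toStage8Params) θ.εbg p.K (genSeq (betaOfRecord₉ F N θ) p.g0) k (domAltOfRecord F N θ.ν p.K k))
    (slots₁₀ : ∀ (θ : Stage9Params F N) (hP : θ.Provisos), θ.Admissible → D = datumOfRecord₉ F N θ hP →
      (∀ P, w.up P = upOfRecord₅C F N (θ.toStage5 F N) P) → ∀ P : B12.RunParams,
        B9LeafX (θ.res.Y P) →
          (B10.Thm1PrintedCompact (θ.res.X P).runs10 ∧ B10.Thm2Printed (θ.res.X P).runs10) →
            B11Leaf (θ.res.Z P) → B12Sec2to5.Lemma4Printed (θ.res.X P).F12 (θ.res.X P).c12 →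
              B13.Lemma1Printed (θ.res.X P).S13 (θ.res.X P).c13 ∧ B13.Lemma2Printed (θ.res.X P).S13 (θ.res.X P).c13 ∧
                B13.Lemma3Printed (θ.res.X P).S13 (θ.res.X P).c13)
    (slots₁₁₁₃ : ∀ (θ : Stage9Params F N) (hP : θ.Provisos), θ.Admissible → D = datumOfRecord₉ F N θ hP →
      (∀ P, w.up P = upOfRecord₅C F N (θ.toStage5 F N) P) → ∀ P : B12.RunParams,
        ((leavesP w P).smallCouplings → SLaw₉ F N θ P 0) ∧
        ((leavesP w P).b7 → (leavesP w P).b8 → (leavesP w P).b9 → (leavesP w P).b10 → (leavesP w P).b11 →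
          (leavesP w P).smallCouplings → (leavesP w P).smallFieldInductive → (leavesP w P).flowControl →
            ∀ k, k < P.K → SLaw₉ F N θ P k → TLaw₉ F N θ P k) ∧
        (∀ k, k < P.K → TLaw₉ F N θ P k → SLaw₉ F N θ P (k + 1)) ∧
        ((genFlow (betaOfRecord₉ F N θ) P.g0).InInterval w.γ P.K → ∀ k, k ≤ P.K → SLaw₉ F N θ P k →
          ∀ U : GaugeField (F.P P.K) k (SU N),
            chiOfRecord F N θ.ν (gOfRecord₉ F N θ P) P.K k U *
                  Real.exp (-(1 / (gOfRecord₉ F N θ P k) ^ 2 * wilsonBGOfRecord F N θ.εbg P k U)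
                    - w.em (gOfRecord₉ F N θ P k) * (Fintype.card (Site (F.P P.K) k) : ℝ)) ≤ densOfRecord₉ F N θ P k U ∧
            densOfRecord₉ F N θ P k U ≤ Real.exp (w.ep (gOfRecord₉ F N θ P k) * (Fintype.card (Site (F.P P.K) k) : ℝ))))
    (slots₁₂ : ∀ (θ : Stage9Params F N) (hP : θ.Provisos), θ.Admissible → D = datumOfRecord₉ F N θ hP →
      (∀ P, w.up P = upOfRecord₅C F N (θ.toStage5 F N) P) → ∀ P : B12.RunParams, B15Leaf (θ.res.W P))
    (hlo : FlowStep.BetaLowerH w.b γ₀ D.βfun) (hhi : FlowStep.BetaUpperH w.βup γ₀ D.βfun) :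
    B16.EndStatementBPrinted D.C :=
  have h₉ := isRecordOfRecord₉C_of_isRecordOfRecord₉CB10Y h
  have hN := B16NodeKnitRecord9.nodes_N11_N13_of_isRecordOfRecord₉C h₉ slots₁₁₁₃
  N24_at_record₉C h₉ hγ₀ (N24_b8_main_of_isRecordOfRecord₉C_of_slot h₉ slots₀₅) (N24_b9_main_of_isRecordOfRecord₉CB10Y_of_opsSlot h hops₀₆)
    (N24_b11_main_of_isRecordOfRecord₉C_of_slot h₉ slots₀₇) (N24_b10_main_of_isRecordOfRecord₉CB10Y_of_printedUV3V h hUV₀₈)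
    (B12NodeKnitRecord9.b12_main_at_record₉C_of_leaf h₉ slot12 h11dom hcomp) (N24_b13_main_of_isRecordOfRecord₉C_of_slot h₉ slots₁₀)
    (fun P => (hN P).1) (N24_b15_main_of_isRecordOfRecord₉C_of_slot h₉ slots₁₂) (fun P => (hN P).2) hlo hhi

/-- **N24 · (B2) at a `₉CB10Y` record with THE TWO CARRIER-PINNED CHILDREN AND THE THREE STAGE-9-NATIVE CHILDREN BY NAME, the four residual-carrier children as by-name
binders** (for consumers already holding `∀ P, Dag.Bk_main (leavesP w P)` for N05 N07 N10 N12). [cite: Balaban1989LargeFieldII, Thm 1 p.355, (0.1) pp.355–356, p.391; Balaban1988Convergent, Thm 1 p.262, Theorem p.245, p.244; Balaban1987RG1, Thm 3 p.264, Lemma 4 (3.53) p.280; Balaban1985UV3, Thm 1 p.257 + Thm 2 p.272; Balaban1985BackgroundPropagators, Thms 3.1–3.15 pp.397–432 (bookkeeping over the carrier-pinned Stage-9 record)] -/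
theorem N24_at_record₉CB10Y_knit_N09_N11_N13 (h : IsRecordOfRecord₉CB10Y F N D w) {γ₀ : ℝ} (hγ₀ : w.γ ≤ γ₀)
    (h05 : ∀ P : B12.RunParams, Dag.B8_main (leavesP w P))
    (hops₀₆ : ∀ (θ : Stage9Params F N) (hP : θ.Provisos) (Mstar : ℕ) (ops : OpsY N θ.toStage3Params Mstar), θ.Admissible →
      D = datumOfRecord₉ F N θ hP →
      (∀ P, w.up P = upOfRecord₅C F N (((θ.toStage5 F N).pinB10 F N).pinY F N (Y9OfRecord N θ.toStage3Params Mstar ops)) P) →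
        B9LeafX (Y9OfRecord N θ.toStage3Params Mstar ops))
    (h07 : ∀ P : B12.RunParams, Dag.B11_main (leavesP w P))
    (hUV₀₈ : ∀ L : ℕ, Odd L → 1 < L → w.L = (L : ℝ) → PrintedUV3V N L)
    (h10 : ∀ P : B12.RunParams, Dag.B13_main (leavesP w P)) (h12 : ∀ P : B12.RunParams, Dag.B15_main (leavesP w P))
    (slot12 : ∀ (θ : Stage9Params F N) (hP : θ.Provisos), θ.Admissible → D = datumOfRecord₉ F N θ hP → w.γ ≤ θ.γ →
      (∀ P, w.up P = upOfRecord₅C F N (θ.toStage5 F N) P) → ∀ P : B12.RunParams, B12Sec2to5.Lemma4Printed (θ.res.X P).F12 (θ.res.X P).c12)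
    (h11dom : ∀ (θ : Stage9Params F N) (hP : θ.Provisos), θ.Admissible → D = datumOfRecord₉ F N θ hP → w.γ ≤ θ.γ →
      ∀ (p : B12.RunParams) (k : ℕ), k ≤ p.K →
        ∀ V ∈ domAltOfRecord F N θ.ν p.K k, UkExists F N p.K k θ.εbg V ∧ UniqueUkOrbit F N p.K k θ.εbg V)
    (hcomp : ∀ (θ : Stage9Params F N) (hP : θ.Provisos), θ.Admissible → D = datumOfRecord₉ F N θ hP → w.γ ≤ θ.γ →
      ∀ (p : B12.RunParams) (k : ℕ), k ≤ p.K →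
        HCompT F N (TOfRecord F N) (chi7 F N θ.toStage8Params) θ.εbg p.K (genSeq (betaOfRecord₉ F N θ) p.g0) k (domAltOfRecord F N θ.ν p.K k))
    (slots₁₁₁₃ : ∀ (θ : Stage9Params F N) (hP : θ.Provisos), θ.Admissible → D = datumOfRecord₉ F N θ hP →
      (∀ P, w.up P = upOfRecord₅C F N (θ.toStage5 F N) P) → ∀ P : B12.RunParams,
        ((leavesP w P).smallCouplings → SLaw₉ F N θ P 0) ∧
        ((leavesP w P).b7 → (leavesP w P).b8 → (leavesP w P).b9 → (leavesP w P).b10 → (leavesP w P).b11 →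
          (leavesP w P).smallCouplings → (leavesP w P).smallFieldInductive → (leavesP w P).flowControl →
            ∀ k, k < P.K → SLaw₉ F N θ P k → TLaw₉ F N θ P k) ∧
        (∀ k, k < P.K → TLaw₉ F N θ P k → SLaw₉ F N θ P (k + 1)) ∧
        ((genFlow (betaOfRecord₉ F N θ) P.g0).InInterval w.γ P.K → ∀ k, k ≤ P.K → SLaw₉ F N θ P k →
          ∀ U : GaugeField (F.P P.K) k (SU N),
            chiOfRecord F N θ.ν (gOfRecord₉ F N θ P) P.K k U *
                  Real.exp (-(1 / (gOfRecord₉ F N θ P k) ^ 2 * wilsonBGOfRecord F N θ.εbg P k U)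
                    - w.em (gOfRecord₉ F N θ P k) * (Fintype.card (Site (F.P P.K) k) : ℝ)) ≤ densOfRecord₉ F N θ P k U ∧
            densOfRecord₉ F N θ P k U ≤ Real.exp (w.ep (gOfRecord₉ F N θ P k) * (Fintype.card (Site (F.P P.K) k) : ℝ))))
    (hlo : FlowStep.BetaLowerH w.b γ₀ D.βfun) (hhi : FlowStep.BetaUpperH w.βup γ₀ D.βfun) :
    B16.EndStatementBPrinted D.C :=
  have h₉ := isRecordOfRecord₉C_of_isRecordOfRecord₉CB10Y h
  have hN := B16NodeKnitRecord9.nodes_N11_N13_of_isRecordOfRecord₉C h₉ slots₁₁₁₃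
  N24_at_record₉C h₉ hγ₀ h05 (N24_b9_main_of_isRecordOfRecord₉CB10Y_of_opsSlot h hops₀₆) h07
    (N24_b10_main_of_isRecordOfRecord₉CB10Y_of_printedUV3V h hUV₀₈) (B12NodeKnitRecord9.b12_main_at_record₉C_of_leaf h₉ slot12 h11dom hcomp) h10
    (fun P => (hN P).1) h12 (fun P => (hN P).2) hlo hhi

/-! ## §2. The β-binders READ AT THE MERGED β OF RECORD (`betaOfRecord₉ = betaOfRecord₈ ∘ toStage8Params`, RN-representative — RIDER №6; the pins are UP-SIDE) -/

/-- **N24 · (B2) at a `₉CB10Y` record, every child by name, with the β-binders READ AT THE MERGED β OF RECORD along the world's own box `]0, w.γ]^{k+1}`**: the datum of a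
`₉CB10Y` record IS `datumOfRecord₉ F N θ h` for its presenting `θ` (the carrier pins are UP-SIDE, `datumOfRecord₉_pinB10 ∕ _pinY`), so module 16 §2's iffs
`N24_betaLowerH_iff_merged₉ ∕ N24_betaUpperH_iff_merged₉` apply at that `θ` verbatim.  WHICH CHILD BLOCKS at `₉CB10Y`, kernel form: the hypothesis list — N08's printed slot,
N06's operator-layer leaf, four residual sockets, N09's three inputs, the four N11∕N13 slots, and two bounds on the merged β of record (lower `b > 0` UNPRINTED, T09.F =
NODE O; upper β⁺ [Balaban1987RG1] p. 264).  β-VERSION (RIDER №6): RN-representative β; no β-side binder booked at Stage 9 or on the carrier chain; version repair in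
`Record10` (`betaOfRecord₉c`, continuous-version transport). [cite: Balaban1989LargeFieldII, Thm 1 p.355, (0.1) pp.355–356, p.387, p.391; Balaban1987RG1, (1.20)–(1.22) p.264, (2.12)–(2.14) p.268, Thm 3 p.264, Lemma 4 (3.53) p.280; Balaban1988Convergent, Thm 1 p.262, Theorem p.245, p.244; Balaban1985UV3, Thm 1 p.257 + Thm 2 p.272; Balaban1985BackgroundPropagators, Thms 3.1–3.15 pp.397–432 (bookkeeping over the carrier-pinned Stage-9 record)] -/
theorem N24_at_record₉CB10Y_knit_all_of_betaMerged_pinned (h : IsRecordOfRecord₉CB10Y F N D w)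
    (slots₀₅ : ∀ (θ : Stage9Params F N) (hP : θ.Provisos), θ.Admissible → D = datumOfRecord₉ F N θ hP →
      (∀ P, w.up P = upOfRecord₅C F N (θ.toStage5 F N) P) → ∀ P : B12.RunParams,
        B8LeafR (θ.res.X P).d8 (θ.res.X P).L8 (θ.res.X P).C₂ (θ.res.X P).B₁' (θ.res.X P).B₀' (θ.res.X P).B₁ (θ.res.X P).B₂ (θ.res.X P).c₁
          (θ.res.X P).inp8 (θ.res.X P).B₀β (θ.res.X P).loc8 (θ.res.X P).fam8R (θ.res.X P).lan8 (θ.res.X P).cub8 (θ.res.X P).toAxial8)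
    (hops₀₆ : ∀ (θ : Stage9Params F N) (hP : θ.Provisos) (Mstar : ℕ) (ops : OpsY N θ.toStage3Params Mstar), θ.Admissible →
      D = datumOfRecord₉ F N θ hP →
      (∀ P, w.up P = upOfRecord₅C F N (((θ.toStage5 F N).pinB10 F N).pinY F N (Y9OfRecord N θ.toStage3Params Mstar ops)) P) →
        B9LeafX (Y9OfRecord N θ.toStage3Params Mstar ops))
    (slots₀₇ : ∀ (θ : Stage9Params F N) (hP : θ.Provisos), θ.Admissible → D = datumOfRecord₉ F N θ hP →
      (∀ P, w.up P = upOfRecord₅C F N (θ.toStage5 F N) P) → ∀ P : B12.RunParams, B11Leaf (θ.res.Z P))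
    (hUV₀₈ : ∀ L : ℕ, Odd L → 1 < L → w.L = (L : ℝ) → PrintedUV3V N L)
    (slot12 : ∀ (θ : Stage9Params F N) (hP : θ.Provisos), θ.Admissible → D = datumOfRecord₉ F N θ hP → w.γ ≤ θ.γ →
      (∀ P, w.up P = upOfRecord₅C F N (θ.toStage5 F N) P) → ∀ P : B12.RunParams, B12Sec2to5.Lemma4Printed (θ.res.X P).F12 (θ.res.X P).c12)
    (h11dom : ∀ (θ : Stage9Params F N) (hP : θ.Provisos), θ.Admissible → D = datumOfRecord₉ F N θ hP → w.γ ≤ θ.γ →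
      ∀ (p : B12.RunParams) (k : ℕ), k ≤ p.K →
        ∀ V ∈ domAltOfRecord F N θ.ν p.K k, UkExists F N p.K k θ.εbg V ∧ UniqueUkOrbit F N p.K k θ.εbg V)
    (hcomp : ∀ (θ : Stage9Params F N) (hP : θ.Provisos), θ.Admissible → D = datumOfRecord₉ F N θ hP → w.γ ≤ θ.γ →
      ∀ (p : B12.RunParams) (k : ℕ), k ≤ p.K →
        HCompT F N (TOfRecord F N) (chi7 F N θ.toStage8Params) θ.εbg p.K (genSeq (betaOfRecord₉ F N θ) p.g0) k (domAltOfRecord F N θ.ν p.K k))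
    (slots₁₀ : ∀ (θ : Stage9Params F N) (hP : θ.Provisos), θ.Admissible → D = datumOfRecord₉ F N θ hP →
      (∀ P, w.up P = upOfRecord₅C F N (θ.toStage5 F N) P) → ∀ P : B12.RunParams,
        B9LeafX (θ.res.Y P) →
          (B10.Thm1PrintedCompact (θ.res.X P).runs10 ∧ B10.Thm2Printed (θ.res.X P).runs10) →
            B11Leaf (θ.res.Z P) → B12Sec2to5.Lemma4Printed (θ.res.X P).F12 (θ.res.X P).c12 →
              B13.Lemma1Printed (θ.res.X P).S13 (θ.res.X P).c13 ∧ B13.Lemma2Printed (θ.res.X P).S13 (θ.res.X P).c13 ∧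
                B13.Lemma3Printed (θ.res.X P).S13 (θ.res.X P).c13)
    (slots₁₁₁₃ : ∀ (θ : Stage9Params F N) (hP : θ.Provisos), θ.Admissible → D = datumOfRecord₉ F N θ hP →
      (∀ P, w.up P = upOfRecord₅C F N (θ.toStage5 F N) P) → ∀ P : B12.RunParams,
        ((leavesP w P).smallCouplings → SLaw₉ F N θ P 0) ∧
        ((leavesP w P).b7 → (leavesP w P).b8 → (leavesP w P).b9 → (leavesP w P).b10 → (leavesP w P).b11 →
          (leavesP w P).smallCouplings → (leavesP w P).smallFieldInductive → (leavesP w P).flowControl →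
            ∀ k, k < P.K → SLaw₉ F N θ P k → TLaw₉ F N θ P k) ∧
        (∀ k, k < P.K → TLaw₉ F N θ P k → SLaw₉ F N θ P (k + 1)) ∧
        ((genFlow (betaOfRecord₉ F N θ) P.g0).InInterval w.γ P.K → ∀ k, k ≤ P.K → SLaw₉ F N θ P k →
          ∀ U : GaugeField (F.P P.K) k (SU N),
            chiOfRecord F N θ.ν (gOfRecord₉ F N θ P) P.K k U *
                  Real.exp (-(1 / (gOfRecord₉ F N θ P k) ^ 2 * wilsonBGOfRecord F N θ.εbg P k U)
                    - w.em (gOfRecord₉ F N θ P k) * (Fintype.card (Site (F.P P.K) k) : ℝ)) ≤ densOfRecord₉ F N θ P k U ∧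
            densOfRecord₉ F N θ P k U ≤ Real.exp (w.ep (gOfRecord₉ F N θ P k) * (Fintype.card (Site (F.P P.K) k) : ℝ))))
    (slots₁₂ : ∀ (θ : Stage9Params F N) (hP : θ.Provisos), θ.Admissible → D = datumOfRecord₉ F N θ hP →
      (∀ P, w.up P = upOfRecord₅C F N (θ.toStage5 F N) P) → ∀ P : B12.RunParams, B15Leaf (θ.res.W P))
    (hβm : ∀ (θ : Stage9Params F N) (hP : θ.Provisos), θ.Admissible → D = datumOfRecord₉ F N θ hP → w.γ ≤ θ.γ →
      letI := θ.instVβ₁; letI := θ.instVβ₂; letI := θ.instιβ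
      FlowStep.BetaLowerH w.b w.γ (betaMerged F (mergedTermFamilyMat F N (chi7 F N θ.toStage8Params) θ.εbg) θ.ρ8 θ.bV) ∧
        FlowStep.BetaUpperH w.βup w.γ (betaMerged F (mergedTermFamilyMat F N (chi7 F N θ.toStage8Params) θ.εbg) θ.ρ8 θ.bV)) :
    B16.EndStatementBPrinted D.C := by
  obtain ⟨θ, hP, -, -, hθ, hD, -, hγ, -, -⟩ := id h
  obtain ⟨hlo, hhi⟩ := hβm θ hP hθ hD hγ.2
  exact N24_at_record₉CB10Y_knit_all_pinned h le_rfl slots₀₅ hops₀₆ slots₀₇ hUV₀₈ slot12 h11dom hcomp slots₁₀ slots₁₁₁₃ slots₁₂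
    ((N24_betaLowerH_iff_merged₉ θ hP hD hγ.2).mpr hlo) ((N24_betaUpperH_iff_merged₉ θ hP hD hγ.2).mpr hhi)

/-! ## §3. The item body in its literal shape at a `₉CB10Y` record -/

/-- **The item body (stmt-QuantumFields-19183 `StabilityBAtRecord`, rev 0) in its LITERAL SHAPE at general `N`, at a `₉CB10Y` record, every child by name**:
`IsDatumOfRecord₀ F N D ∧ B16.EndStatementBPrinted D.C ∧ ∃ γ₁ > 0, ∀ γ ∈ ]0, γ₁], ∃ P, (D.C P).flow.InInterval γ P.K` — Stage 0 from the record
(`isDatumOfRecord₀_of_isRecordOfRecord₉C` through the refinement), (B2) by §1, `γ₁ := γ₀` and the run `⟨K, m, g₀⟩` of module 8's K-indexed window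
(`N24_window_allK_of_betaUpperH`, from `hhi` alone). [cite: Balaban1989LargeFieldII, Thm 1 p.355 + p.391; Balaban1987RG1, (0.4) p.253, (0.18)–(0.20) pp.255–256 and p.264 (bookkeeping + elementary window)] -/
theorem N24_stabilityB_itemShape₉CB10Y_knit_all_pinned (h : IsRecordOfRecord₉CB10Y F N D w) {γ₀ : ℝ} (hγ₀ : w.γ ≤ γ₀) (K m : ℕ)
    (slots₀₅ : ∀ (θ : Stage9Params F N) (hP : θ.Provisos), θ.Admissible → D = datumOfRecord₉ F N θ hP →
      (∀ P, w.up P = upOfRecord₅C F N (θ.toStage5 F N) P) → ∀ P : B12.RunParams,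
        B8LeafR (θ.res.X P).d8 (θ.res.X P).L8 (θ.res.X P).C₂ (θ.res.X P).B₁' (θ.res.X P).B₀' (θ.res.X P).B₁ (θ.res.X P).B₂ (θ.res.X P).c₁
          (θ.res.X P).inp8 (θ.res.X P).B₀β (θ.res.X P).loc8 (θ.res.X P).fam8R (θ.res.X P).lan8 (θ.res.X P).cub8 (θ.res.X P).toAxial8)
    (hops₀₆ : ∀ (θ : Stage9Params F N) (hP : θ.Provisos) (Mstar : ℕ) (ops : OpsY N θ.toStage3Params Mstar), θ.Admissible →
      D = datumOfRecord₉ F N θ hP →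
      (∀ P, w.up P = upOfRecord₅C F N (((θ.toStage5 F N).pinB10 F N).pinY F N (Y9OfRecord N θ.toStage3Params Mstar ops)) P) →
        B9LeafX (Y9OfRecord N θ.toStage3Params Mstar ops))
    (slots₀₇ : ∀ (θ : Stage9Params F N) (hP : θ.Provisos), θ.Admissible → D = datumOfRecord₉ F N θ hP →
      (∀ P, w.up P = upOfRecord₅C F N (θ.toStage5 F N) P) → ∀ P : B12.RunParams, B11Leaf (θ.res.Z P))
    (hUV₀₈ : ∀ L : ℕ, Odd L → 1 < L → w.L = (L : ℝ) → PrintedUV3V N L)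
    (slot12 : ∀ (θ : Stage9Params F N) (hP : θ.Provisos), θ.Admissible → D = datumOfRecord₉ F N θ hP → w.γ ≤ θ.γ →
      (∀ P, w.up P = upOfRecord₅C F N (θ.toStage5 F N) P) → ∀ P : B12.RunParams, B12Sec2to5.Lemma4Printed (θ.res.X P).F12 (θ.res.X P).c12)
    (h11dom : ∀ (θ : Stage9Params F N) (hP : θ.Provisos), θ.Admissible → D = datumOfRecord₉ F N θ hP → w.γ ≤ θ.γ →
      ∀ (p : B12.RunParams) (k : ℕ), k ≤ p.K →
        ∀ V ∈ domAltOfRecord F N θ.ν p.K k, UkExists F N p.K k θ.εbg V ∧ UniqueUkOrbit F N p.K k θ.εbg V)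
    (hcomp : ∀ (θ : Stage9Params F N) (hP : θ.Provisos), θ.Admissible → D = datumOfRecord₉ F N θ hP → w.γ ≤ θ.γ →
      ∀ (p : B12.RunParams) (k : ℕ), k ≤ p.K →
        HCompT F N (TOfRecord F N) (chi7 F N θ.toStage8Params) θ.εbg p.K (genSeq (betaOfRecord₉ F N θ) p.g0) k (domAltOfRecord F N θ.ν p.K k))
    (slots₁₀ : ∀ (θ : Stage9Params F N) (hP : θ.Provisos), θ.Admissible → D = datumOfRecord₉ F N θ hP →
      (∀ P, w.up P = upOfRecord₅C F N (θ.toStage5 F N) P) → ∀ P : B12.RunParams,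
        B9LeafX (θ.res.Y P) →
          (B10.Thm1PrintedCompact (θ.res.X P).runs10 ∧ B10.Thm2Printed (θ.res.X P).runs10) →
            B11Leaf (θ.res.Z P) → B12Sec2to5.Lemma4Printed (θ.res.X P).F12 (θ.res.X P).c12 →
              B13.Lemma1Printed (θ.res.X P).S13 (θ.res.X P).c13 ∧ B13.Lemma2Printed (θ.res.X P).S13 (θ.res.X P).c13 ∧
                B13.Lemma3Printed (θ.res.X P).S13 (θ.res.X P).c13)
    (slots₁₁₁₃ : ∀ (θ : Stage9Params F N) (hP : θ.Provisos), θ.Admissible → D = datumOfRecord₉ F N θ hP →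
      (∀ P, w.up P = upOfRecord₅C F N (θ.toStage5 F N) P) → ∀ P : B12.RunParams,
        ((leavesP w P).smallCouplings → SLaw₉ F N θ P 0) ∧
        ((leavesP w P).b7 → (leavesP w P).b8 → (leavesP w P).b9 → (leavesP w P).b10 → (leavesP w P).b11 →
          (leavesP w P).smallCouplings → (leavesP w P).smallFieldInductive → (leavesP w P).flowControl →
            ∀ k, k < P.K → SLaw₉ F N θ P k → TLaw₉ F N θ P k) ∧
        (∀ k, k < P.K → TLaw₉ F N θ P k → SLaw₉ F N θ P (k + 1)) ∧
        ((genFlow (betaOfRecord₉ F N θ) P.g0).InInterval w.γ P.K → ∀ k, k ≤ P.K → SLaw₉ F N θ P k →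
          ∀ U : GaugeField (F.P P.K) k (SU N),
            chiOfRecord F N θ.ν (gOfRecord₉ F N θ P) P.K k U *
                  Real.exp (-(1 / (gOfRecord₉ F N θ P k) ^ 2 * wilsonBGOfRecord F N θ.εbg P k U)
                    - w.em (gOfRecord₉ F N θ P k) * (Fintype.card (Site (F.P P.K) k) : ℝ)) ≤ densOfRecord₉ F N θ P k U ∧
            densOfRecord₉ F N θ P k U ≤ Real.exp (w.ep (gOfRecord₉ F N θ P k) * (Fintype.card (Site (F.P P.K) k) : ℝ))))
    (slots₁₂ : ∀ (θ : Stage9Params F N) (hP : θ.Provisos), θ.Admissible → D = datumOfRecord₉ F N θ hP →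
      (∀ P, w.up P = upOfRecord₅C F N (θ.toStage5 F N) P) → ∀ P : B12.RunParams, B15Leaf (θ.res.W P))
    (hlo : FlowStep.BetaLowerH w.b γ₀ D.βfun) (hhi : FlowStep.BetaUpperH w.βup γ₀ D.βfun) :
    IsDatumOfRecord₀ F N D ∧ B16.EndStatementBPrinted D.C ∧
      ∃ γ₁ : ℝ, 0 < γ₁ ∧ ∀ γ : ℝ, 0 < γ → γ ≤ γ₁ → ∃ P : B12.RunParams, (D.C P).flow.InInterval γ P.K := by
  have h₉ := isRecordOfRecord₉C_of_isRecordOfRecord₉CB10Y h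
  refine ⟨isDatumOfRecord₀_of_isRecordOfRecord₉C h₉,
    N24_at_record₉CB10Y_knit_all_pinned h hγ₀ slots₀₅ hops₀₆ slots₀₇ hUV₀₈ slot12 h11dom hcomp slots₁₀ slots₁₁₁₃ slots₁₂ hlo hhi,
    γ₀, (gamma_pos_of_isRecordOfRecord₉C h₉).trans_le hγ₀, fun γ hγ hγle => ?_⟩
  obtain ⟨g0, -, hrun⟩ := N24_window_allK_of_betaUpperH D hhi hγ hγle m K
  exact ⟨⟨K, m, g0⟩, hrun⟩

/-! ## §4. `₉CB10Y` is closed under γ-lowering re-lettering of the world (the `hRL` of design E) -/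

/-- **Re-lettering a `₉CB10Y` record's world** — new interval letter `γ' ∈ ]0, w.γ]`, any lower letter `b' > 0`, any upper letter `βup'`, any exponent letters `(e₋, e₊)`,
same `C`, `up`, `L` — gives again a `₉CB10Y` record over the SAME datum (the window clause is `0 < w.γ ≤ θ.γ`; the pins read no world letter).  The `hRL` hypothesis of the
design-E faces (module 7) for `Rec := IsRecordOfRecord₉CB10Y` — NOT instantiated (X-[B8] ∕ B12 ∕ B13, Z, W and the [B9] operator layer are residual on this chain).
[cite: Balaban1989LargeFieldII, Thm 1 p.355 («γ sufficiently small»; bookkeeping)] -/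
theorem N24_isRecordOfRecord₉CB10Y_reletter (h : IsRecordOfRecord₉CB10Y F N D w) {γ' b' : ℝ} (hγ' : 0 < γ') (hγ'le : γ' ≤ w.γ) (hb' : 0 < b')
    (βup' : ℝ) (em ep : ℝ → ℝ) :
    IsRecordOfRecord₉CB10Y F N D { w with γ := γ', b := b', b_pos := hb', βup := βup', em := em, ep := ep } := by
  obtain ⟨θ, hP, Mstar, ops, hθ, hD, hC, hγ, hL, hup⟩ := h
  exact ⟨θ, hP, Mstar, ops, hθ, hD, hC, ⟨hγ', hγ'le.trans hγ.2⟩, hL, hup⟩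

/-! ## §5. The remaining socket display is strength-neutral at `₉CB10Y` -/

/-- **LOGICAL STATUS of the socket display at a `₉CB10Y` record** (module 16's `N24_leaves_iff_binders₉C` through the refinement): GIVEN N08, the four world leaves
`b8 ∧ b9 ∧ b11 ∧ rBasicStep` at every run (⇔ the X-[B8] ∕ ops-keyed [B9] ∕ Z ∕ W slots, §0 and module 16 §0) are EQUIVALENT to the four by-name binders N05 ∧ N06 ∧ N07 ∧ N12.
[cite: Balaban1985RegularSpaces, Thm 8 p.101; Balaban1985BackgroundPropagators, Thm 3.15 p.432; Balaban1985Variational, Thm 1 p.279; Balaban1989LargeFieldI, Prop. 1 p.194 (bookkeeping)] -/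
theorem N24_leaves_iff_binders₉CB10Y (h : IsRecordOfRecord₉CB10Y F N D w) (h08 : ∀ P : B12.RunParams, Dag.B10_main (leavesP w P)) :
    ((∀ P : B12.RunParams, (w.up P).b8) ∧ (∀ P : B12.RunParams, (w.up P).b9) ∧ (∀ P : B12.RunParams, (w.up P).b11) ∧
        ∀ P : B12.RunParams, (w.up P).rBasicStep) ↔
      ((∀ P : B12.RunParams, Dag.B8_main (leavesP w P)) ∧ (∀ P : B12.RunParams, Dag.B9_main (leavesP w P)) ∧
        (∀ P : B12.RunParams, Dag.B11_main (leavesP w P)) ∧ ∀ P : B12.RunParams, Dag.B15_main (leavesP w P)) :=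
  N24_leaves_iff_binders₉C (isRecordOfRecord₉C_of_isRecordOfRecord₉CB10Y h) h08

end Literature.MathematicalPhysics.QuantumFieldTheory.Balaban1983to89.Node00

end
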